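import Summits.ABC.IUTFork.Conditional.InhUniformBandCellsFrey31117999167337103924704LoA
import Summits.ABC.IUTFork.Conditional.InhUniformBandCellsFrey31117999167337103924704LoB
import Summits.ABC.IUTFork.Conditional.InhUniformBandCellsFrey31117999167337103924704SixtySevenLevels
import Summits.ABC.IUTFork.Conditional.InhUniformBandShapesFrey31117999167337103924704
import Summits.ABC.IUTFork.Conditional.WRowFrey283Packages
import HarnessLib

/-!
# R-W «W:INH-BANDS-REFUTED-SIDE», INHABITED side — `2⁵·67⁸·107·22381 + 5⁴·53⁶·353⁵ = 3²²·7¹⁴·43·83` AT THE FOUR TAIL LEVELS `l ∈ {1322669, 1322681, 1322689, 1322693}`: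
# the hull licence S_H HOLDS at EVERY genuine Θ-volume datum over `(ratPoint(((2 ^ 5 * 67 ^ 8 * 107 * 22381 : ℕ) : ℚ) / (3 ^ 22 * 7 ^ 14 * 43 * 83 : ℕ)), l)` at these four primes,
# with NO local-type hypothesis (abc-iut-plan C-R100 (c) / C-R101 (c): exact-cell tail addendum to `InhUniformBandFrey31117999167337103924704`, p504420)

PROOF-ONLY file (D-0012; 0 definitions, 0 `Prop` facts) of the abc-iut cell — D-0079 RESCUE sub-cell R-W «WINDOW Θ-SIDE INEQUALITY», seat abc-iut-W-neg-1
(gen 4), row «W:INH-BANDS-REFUTED-SIDE». The uniform theorem `WRow.licence_frey31117999167337103924704_uniform` (p504420) covers every prime `l ≥ 1322706`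
(the floor-free threshold of the binding prime `67` with the sharp inner slot); this seat's refuted bands cover every prime `5 ≤ l ≤ 1322640` (p497594, p498239,
p501634). The primes strictly in between are `1322641, 1322669, 1322681, 1322689, 1322693`. THIS FILE settles the last four on the INHABITED side, by the SAME
socket telescope (verbatim structure of p504420: `Cor312Prov.licence_settingPrVolSharp_pilotDataOfK_of_orders_rat`, conjugacy of the bad fibre at `d_mod = 1`,
one-sided local inputs BY NAME, the LOWER local-type classes of `WRowFrey31117999167337103924704Packages` incl. the TWIST class, the shapes of
`InhUniformBandShapesFrey31117999167337103924704`) over the tail cells: `InhUniformBandCellsFrey31117999167337103924704LoA / LoB` (the non-binding primes, re-certified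
from `l ≥ 1322669`) and `InhUniformBandCellsFrey31117999167337103924704SixtySevenLevels` (over `67`: `m ≥ 2` floor-free from `l ≥ 1322669`; `m = 1` at each of the
four levels floor-free on the labels `j ≤ (l−1)/2 − 1` and the EXACT integer cell, floor included, at the top label `j = (l−1)/2`, where the floor-free form fails).
**`l = 1322641` stays OPEN AS TYPED, of record:** there the exact cell over `67` at `m = 1` FAILS at the top label under the kernel's slot reading `ρin = ⌊e/66⌋`
(desk: it holds under `⌊e/66⌋ + 1`, a reading the slot witness `WRow.inner_witness_slot` does not supply; tie-sensitive), and no refuting hull cell is certified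
there either. TAKES NO SIDE on [IUTchIII] Cor. 3.12 (S. Mochizuki, *Inter-universal Teichmüller theory III*, Cor. 3.12 p. 173–174; Step (xi-f) p. 184) or on
any author; «inhabited as typed» ≠ «asserted in print».

WHAT IS PROVED (namespace `Summit.ABC.IUTFork.Conditional`): **`WRow.licence_frey31117999167337103924704_levels`** — for `l ∈ {1322669, 1322681, 1322689, 1322693}`,
EVERY genuine Θ-volume datum `T` and EVERY pair of realising Θ- and q-ideles, `Thm311ToCor312.Licence` HOLDS at `settingPrVolSharp (pilotDataOfK T.D T.K) …`.
READING (neutral; numbers, not adjectives): together with p504420 and the refuted bands, EVERY prime `l ≥ 5` of this triple's axis is decided by theorem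
EXCEPT the single prime `l = 1322641`: ¬S_H ∀T for `5 ≤ l ≤ 1322640`; S_H ∀T for `l ∈ {1322669, 1322681, 1322689, 1322693}` and every prime `l ≥ 1322706`
(no other primes lie in `(1322640, 1322706)`). Admissibility / (P6) of `(ratPoint λ, l)` and NON-EMPTINESS of the datum type are NOT claimed. HONEST SCOPE:
OUR sharp containers; STRONGER-THAN-PRINT hull reading; nothing about the printed inequality or any author's intended hull; typed ≠ proved; instantiated ≠
endorsed; inhabited-as-typed ≠ true-in-print; no abc claim.
[cite: Mochizuki2012, IUTchI Def. 3.1 (b),(c) pp. 61–62, Rmk. 3.1.5 p. 65, Ex. 3.2 (iv) p. 71; IUTchIII Cor. 3.12 Step (xi-f) p. 184; IUTchIV Prop. 1.1 p. 9, Prop. 1.2 (i)(ii) p. 10, Prop. 1.3 (i) p. 11, Prop. 1.4 (ii) p. 13, Thm. 1.10 p. 22, Cor. 2.2 (ii) proof (P5) p. 46]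
[cite: DupuyHilado2025, §3.3, §3.4, §4.9, §4.12] [cite: NeukirchANT1999, Ch. II (5.5)–(5.7)] [cite: SilvermanATAEC1994, V.5 Thm. 5.3 and Cor. 5.4] [cite: SerreLocalFields1979, Ch. III §6 Prop. 13]
[claim: Mochizuki2012, status: disputed] for every IUT sentence.
-/

noncomputable section

open Set Function Metric NumberField IsDedekindDomain

namespace Summit.ABC.IUTFork.Conditional

open Thm311 Thm311.Real Cor312 Cor312Vol Cor312Prov Literature.IUT.LogThetaLattice Literature.IUT.LogVolume
  Literature.IUT.HodgeTheaters Literature.IUT.LogVolume.Cor22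
open Literature.NumberTheory.NumberFields Literature.NumberTheory.GaloisRepresentations.Ultrametric
open Literature.NumberTheory.DiophantineGeometry Literature.NumberTheory.DiophantineGeometry.GenEll

set_option maxHeartbeats 1600000 in
/-- **«W:INH-BANDS-REFUTED-SIDE», INHABITED SIDE, UNCONDITIONAL — `2⁵·67⁸·107·22381 + 5⁴·53⁶·353⁵ = 3²²·7¹⁴·43·83` at the four TAIL LEVELS `l ∈ {1322669, 1322681, 1322689, 1322693}`** (abc-iut-plan C-R100 (c): the primes strictly between this seat's refuted band end `1322640` and its uniform inhabited threshold `1322706`, EXCEPT `l = 1322641`, which stays OPEN AS TYPED — there the exact cell over `67` fails at the top label under the slot reading `ρin = ⌊e/66⌋` and would need `⌊e/66⌋ + 1`). For each of these four primes `l`, EVERY genuine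
Θ-volume datum `T` at `(ratPoint(((2 ^ 5 * 67 ^ 8 * 107 * 22381 : ℕ) : ℚ) / (3 ^ 22 * 7 ^ 14 * 43 * 83 : ℕ)), l)` and EVERY pair of Θ- and q-ideles realising the pilot divisors of `X := pilotDataOfK T.D T.K`,
abc-iut-c312-1's `Thm311ToCor312.Licence` HOLDS at abc-iut-c312-7's `settingPrVolSharp X …`. NO local-type and NO conjugacy hypothesis: the bad primes are
`{3, 5, 7, 43, 53, 67, 83, 107, 353, 22381} ∖ {l}` (`WRow.bad_prime_frey31117999167337103924704`); the bad completions over each are isometrically `ℚ_p`-isomorphic (`d_mod = 1`), so the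
index is ONE unknown `e_p = E₀(p)·l·m` per prime (`InhBand.shape_frey31117999167337103924704`); one-sided inputs `D = 2e − 1` (W1 wild) / `e − 1`, `ρin = ⌊e/(p−1)⌋` (slot) / `1`,
`ρout = min(p^a − a·e, p^b − b·e)`, `h = 2·v_p(abc)`; the cells of `InhUniformBandCellsFrey31117999167337103924704LoA / LoB` (every `l ≥ 1322669`) and `…SixtySevenLevels` (over `67`: `m ≥ 2` floor-free, `m = 1` with the EXACT cell at the top label) hold at every label for every such `e` and every `l ≥ 1322706`.
[cite: Mochizuki2012, IUTchIII Cor. 3.12 Step (xi-f) p. 184; IUTchIV Prop. 1.1 p. 9, Prop. 1.2 (i)(ii) p. 10, Cor. 2.2 (ii) p. 46] [cite: DupuyHilado2025, §3.3, §3.4, §4.9, §4.12]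
[claim: Mochizuki2012, status: disputed] -/
theorem WRow.licence_frey31117999167337103924704_levels {l : ℕ} (hl4 : l = 1322669 ∨ l = 1322681 ∨ l = 1322689 ∨ l = 1322693) (T : Cor22.ThetaVolumeDatumAt (ratPoint (((2 ^ 5 * 67 ^ 8 * 107 * 22381 : ℕ) : ℚ) / (3 ^ 22 * 7 ^ 14 * 43 * 83 : ℕ))) l) :
    letI := T.instFieldF; letI := T.instNumberFieldF; letI := T.instAlgebraF; letI := T.instFieldK
    letI := T.instNumberFieldK; letI := T.instAlgebraK; letI := T.instFieldFbar; letI := T.instAlgebraFbar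
    letI := T.instAlgebraKFbar; letI := T.instIsElliptic
    ∀ {logv : PadicLogs T.K} (hlog : LogvAnalytic logv) (M : Type) [Field M] [NumberField M]
      (archPk : ∀ (j : (thetaIndex (pilotDataOfK T.D T.K)).Label) (vQ : (thetaIndex (pilotDataOfK T.D T.K)).VQ),
        Set ((logShellsDH (pilotDataOfK T.D T.K) logv).Packet j vQ))
      (archSub : ∀ (j : (thetaIndex (pilotDataOfK T.D T.K)).Label) (v : (thetaIndex (pilotDataOfK T.D T.K)).V),
        Set ((logShellsDH (pilotDataOfK T.D T.K) logv).Packet j ((thetaIndex (pilotDataOfK T.D T.K)).over v)))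
      (Ψ : ℤ → ∀ v : (thetaIndex (pilotDataOfK T.D T.K)).V, v ∈ (thetaIndex (pilotDataOfK T.D T.K)).Vbad →
        Set ((logShellsDH (pilotDataOfK T.D T.K) logv).StarPacket v))
      (act : ℤ → ∀ v : (thetaIndex (pilotDataOfK T.D T.K)).V, v ∈ (thetaIndex (pilotDataOfK T.D T.K)).Vbad →
        (logShellsDH (pilotDataOfK T.D T.K) logv).StarPacket v → Module.End ℚ ((logShellsDH (pilotDataOfK T.D T.K) logv).StarPacket v))
      (Mmod : ℤ → ∀ j : (thetaIndex (pilotDataOfK T.D T.K)).LabelStar, Set ((logShellsDH (pilotDataOfK T.D T.K) logv).GlobalPacket j.1))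
      (region : ℤ → ∀ j : (thetaIndex (pilotDataOfK T.D T.K)).LabelStar, FinDivisor M → ∀ vQ : (thetaIndex (pilotDataOfK T.D T.K)).VQ,
        Set ((logShellsDH (pilotDataOfK T.D T.K) logv).Packet j.1 vQ))
      (n : ℤ) {HT : Type} {LogLink : HT → HT → Type} {IsFull : ∀ {s t : HT}, LogLink s t → Prop}
      (lat : LGPGaussianLogThetaLattice LogLink IsFull)
      {Frd : Type} {IsoF : Frd → Frd → Type} {Ob : Frd → Type} {realify : Frd → Frd} {Strip : Type}
      {IsoS : Strip → Strip → Type} {Mv : ∀ v : (thetaIndex (pilotDataOfK T.D T.K)).V, v ∈ (thetaIndex (pilotDataOfK T.D T.K)).Vbad → Type}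
      [∀ v h, Monoid (Mv v h)]
      (sig : GlobalLGPFrobenioidSignature (thetaIndex (pilotDataOfK T.D T.K)).lstar (thetaIndex (pilotDataOfK T.D T.K)).V
        (· ∈ (thetaIndex (pilotDataOfK T.D T.K)).Vbad) Frd IsoF Ob realify Strip IsoS Mv)
      (split : SplittingMonoids Mv) {ObΔ : Type} {N : ∀ v : (thetaIndex (pilotDataOfK T.D T.K)).V, v ∈ (thetaIndex (pilotDataOfK T.D T.K)).Vbad → Type}
      [∀ v h, Monoid (N v h)] (qData : QPilotData ObΔ N)
      (tq : ∀ (pp : Nat.Primes) (x : (thetaIndex (pilotDataOfK T.D T.K)).Fibre (.inr pp)),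
        haveI : Fact (pp : ℕ).Prime := ⟨pp.2⟩; kOf (pilotDataOfK T.D T.K) pp.1 x)
      (t : ∀ (pp : Nat.Primes) (_ : Fin (pilotDataOfK T.D T.K).lstar) (x : (thetaIndex (pilotDataOfK T.D T.K)).Fibre (.inr pp)),
        haveI : Fact (pp : ℕ).Prime := ⟨pp.2⟩; kOf (pilotDataOfK T.D T.K) pp.1 x)
      (htq0 : ∀ pp x, tq pp x ≠ 0)
      (htq1 : ∀ (pp : Nat.Primes) (x : (thetaIndex (pilotDataOfK T.D T.K)).Fibre (.inr pp)),
        haveI : Fact (pp : ℕ).Prime := ⟨pp.2⟩; placeOf (pilotDataOfK T.D T.K) pp.1 x ∉ (pilotDataOfK T.D T.K).S → ‖tq pp x‖ = 1)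
      (_ht0 : ∀ pp i x, t pp i x ≠ 0)
      (_ht : ∀ (pp : Nat.Primes) (i : Fin (pilotDataOfK T.D T.K).lstar) (x : (thetaIndex (pilotDataOfK T.D T.K)).Fibre (.inr pp)),
        haveI : Fact (pp : ℕ).Prime := ⟨pp.2⟩
        Real.log ‖t pp i x‖ = -((pilotDataOfK T.D T.K).thetaPilot i (placeOf (pilotDataOfK T.D T.K) pp.1 x)) *
          logNorm T.K (placeOf (pilotDataOfK T.D T.K) pp.1 x) / localDegree T.K (placeOf (pilotDataOfK T.D T.K) pp.1 x))
      (_htq : ∀ (pp : Nat.Primes) (x : (thetaIndex (pilotDataOfK T.D T.K)).Fibre (.inr pp)),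
        haveI : Fact (pp : ℕ).Prime := ⟨pp.2⟩
        Real.log ‖tq pp x‖ = -((pilotDataOfK T.D T.K).qPilot (placeOf (pilotDataOfK T.D T.K) pp.1 x)) *
          logNorm T.K (placeOf (pilotDataOfK T.D T.K) pp.1 x) / localDegree T.K (placeOf (pilotDataOfK T.D T.K) pp.1 x)),
      Thm311ToCor312.Licence
        (settingPrVolSharp (pilotDataOfK T.D T.K) hlog M archPk archSub Ψ act Mmod region n lat sig split qData tq t htq0 htq1) := by
  classical
  have hL : 1322669 ≤ l := by omega
  letI := T.instFieldF; letI := T.instNumberFieldF; letI := T.instAlgebraF; letI := T.instFieldK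
  letI := T.instNumberFieldK; letI := T.instAlgebraK; letI := T.instFieldFbar; letI := T.instAlgebraFbar
  letI := T.instAlgebraKFbar; letI := T.instIsElliptic
  intro logv hlog M _ _ archPk archSub Ψ act Mmod region n HT LogLink IsFull lat Frd IsoF Ob realify Strip
    IsoS Mv _ sig split ObΔ N _ qData tq t htq0 htq1 ht0 ht htq
  have hjF : T.E.j = ((jInv (((2 ^ 5 * 67 ^ 8 * 107 * 22381 : ℕ) : ℚ) / (3 ^ 22 * 7 ^ 14 * 43 * 83 : ℕ)) : ℚ) : T.F) := by rw [T.j_eq]; exact eq_ratCast _ _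
  have hl5 : 5 ≤ l := T.D.five_le_l
  have hlP : l.Prime := T.D.l_prime
  have hlstar : (pilotDataOfK T.D T.K).lstar = (l - 1) / 2 := by
    show ((pilotDataOfK T.D T.K).l - 1) / 2 = (l - 1) / 2
    rw [pilotDataOfK_l]
  have hFm : Module.finrank ℚ (fieldOfModuli T.E) = 1 := by
    rw [T.finrank_rat_fieldOfModuli_eq_dmod]
    exact dmod_eq_one_of_degree_le_one (by rw [degree_ratPoint])
  set eF : Nat.Primes → ℕ := fun pp =>
    haveI : Fact (pp : ℕ).Prime := ⟨pp.2⟩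
    if h : ∃ x : (thetaIndex (pilotDataOfK T.D T.K)).Fibre (.inr pp), placeOf (pilotDataOfK T.D T.K) pp.1 x ∈ (pilotDataOfK T.D T.K).S
    then absRamificationIdx (pp : ℕ) (kOf (pilotDataOfK T.D T.K) pp.1 h.choose) else 1 with heF
  set DF : Nat.Primes → ℕ := fun pp => if (pp : ℕ) = 3 then 2 * eF pp - 1 else if (pp : ℕ) = 5 then 2 * eF pp - 1 else eF pp - 1 with hDF
  set hF : Nat.Primes → ℕ := fun pp => if (pp : ℕ) = 3 then 44 else if (pp : ℕ) = 5 then 8 else if (pp : ℕ) = 7 then 28 else if (pp : ℕ) = 43 then 2 else if (pp : ℕ) = 53 then 12 else if (pp : ℕ) = 67 then 16 else if (pp : ℕ) = 83 then 2 else if (pp : ℕ) = 107 then 2 else if (pp : ℕ) = 353 then 10 else 2 with hhF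
  set rinF : Nat.Primes → ℤ := fun pp => if (pp : ℕ) = 67 then (((eF pp / 66 : ℕ)) : ℤ) else 1 with hrinF
  set routF : Nat.Primes → ℤ := fun pp => if (pp : ℕ) = 3 then min ((3 : ℤ) ^ 10 - 10 * (eF pp : ℤ)) ((3 : ℤ) ^ 11 - 11 * (eF pp : ℤ)) else
      if (pp : ℕ) = 5 then min ((5 : ℤ) ^ 1 - 1 * (eF pp : ℤ)) ((5 : ℤ) ^ 2 - 2 * (eF pp : ℤ)) else
      if (pp : ℕ) = 7 then min ((7 : ℤ) ^ 7 - 7 * (eF pp : ℤ)) ((7 : ℤ) ^ 8 - 8 * (eF pp : ℤ)) else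
      if (pp : ℕ) = 43 then min ((43 : ℤ) ^ 0 - 0 * (eF pp : ℤ)) ((43 : ℤ) ^ 1 - 1 * (eF pp : ℤ)) else
      if (pp : ℕ) = 53 then min ((53 : ℤ) ^ 3 - 3 * (eF pp : ℤ)) ((53 : ℤ) ^ 4 - 4 * (eF pp : ℤ)) else
      if (pp : ℕ) = 67 then min ((67 : ℤ) ^ 3 - 3 * (eF pp : ℤ)) ((67 : ℤ) ^ 4 - 4 * (eF pp : ℤ)) else
      if (pp : ℕ) = 83 then min ((83 : ℤ) ^ 0 - 0 * (eF pp : ℤ)) ((83 : ℤ) ^ 1 - 1 * (eF pp : ℤ)) else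
      if (pp : ℕ) = 107 then min ((107 : ℤ) ^ 0 - 0 * (eF pp : ℤ)) ((107 : ℤ) ^ 1 - 1 * (eF pp : ℤ)) else
      if (pp : ℕ) = 353 then min ((353 : ℤ) ^ 2 - 2 * (eF pp : ℤ)) ((353 : ℤ) ^ 3 - 3 * (eF pp : ℤ)) else
      min ((22381 : ℤ) ^ 0 - 0 * (eF pp : ℤ)) ((22381 : ℤ) ^ 1 - 1 * (eF pp : ℤ)) with hroutF
  have heq : ∀ (pp : Nat.Primes) (x : (thetaIndex (pilotDataOfK T.D T.K)).Fibre (.inr pp)),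
      haveI : Fact (pp : ℕ).Prime := ⟨pp.2⟩
      placeOf (pilotDataOfK T.D T.K) pp.1 x ∈ (pilotDataOfK T.D T.K).S →
        absRamificationIdx (pp : ℕ) (kOf (pilotDataOfK T.D T.K) pp.1 x) = eF pp := by
    intro pp x hx
    haveI : Fact (pp : ℕ).Prime := ⟨pp.2⟩
    have hex : ∃ x : (thetaIndex (pilotDataOfK T.D T.K)).Fibre (.inr pp),
        placeOf (pilotDataOfK T.D T.K) pp.1 x ∈ (pilotDataOfK T.D T.K).S := ⟨x, hx⟩
    have h1 : eF pp = absRamificationIdx (pp : ℕ) (kOf (pilotDataOfK T.D T.K) pp.1 hex.choose) := by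
      simp only [heF, dif_pos hex]
    rw [h1]
    exact WRow.absRamificationIdx_kOf_eq_of_finrank_eq_one T.D hFm pp x hex.choose
  have hshape : ∀ (pp : Nat.Primes) (x : (thetaIndex (pilotDataOfK T.D T.K)).Fibre (.inr pp)),
      haveI : Fact (pp : ℕ).Prime := ⟨pp.2⟩
      placeOf (pilotDataOfK T.D T.K) pp.1 x ∈ (pilotDataOfK T.D T.K).S →
        ∃ m : ℕ, 1 ≤ m ∧ eF pp = (if (pp : ℕ) = 3 then 30 else if (pp : ℕ) = 5 then 60 else if (pp : ℕ) = 7 then 15 else if (pp : ℕ) = 43 then 30 else if (pp : ℕ) = 53 then 5 else if (pp : ℕ) = 67 then 15 else if (pp : ℕ) = 83 then 30 else if (pp : ℕ) = 107 then 15 else if (pp : ℕ) = 353 then 3 else 15) * l * m := by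
    intro pp x hx
    rw [← heq pp x hx]
    exact InhBand.shape_frey31117999167337103924704 T pp x hx
  refine Cor312Prov.licence_settingPrVolSharp_pilotDataOfK_of_orders_rat T.D hlog M archPk archSub Ψ act Mmod region n lat sig split qData
    tq t htq0 htq1 ht0 ht htq (jInv (((2 ^ 5 * 67 ^ 8 * 107 * 22381 : ℕ) : ℚ) / (3 ^ 22 * 7 ^ 14 * 43 * 83 : ℕ))) hjF eF DF hF rinF routF (fun pp x hx => ?_)
    (fun pp x y _ _ => Cor312Prov.nonempty_algEquiv_kOf_of_finrank_eq_one T.D hFm pp x y) (fun pp hpp i => ?_)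
  · -- the local packages at a bad place `x | p`
    haveI : Fact (pp : ℕ).Prime := ⟨pp.2⟩
    have hE := heq pp x hx
    obtain ⟨m, hm1, hm⟩ := hshape pp x hx
    obtain ⟨hp2, hpl, -, hcases, hord⟩ := WRow.bad_prime_frey31117999167337103924704 T pp x hx
    rcases hcases with hp | hp | hp | hp | hp | hp | hp | hp | hp | hp
    · -- `p = 3`: `e = 30·l·m`, `h = 44`
      simp only [hp] at hm; norm_num at hm
      have h3 : hF pp = 44 := by simp [hhF, hp]
      have hfac' : (2 ^ 5 * 67 ^ 8 * 107 * 22381 * (5 ^ 4 * 53 ^ 6 * 353 ^ 5) * (3 ^ 22 * 7 ^ 14 * 43 * 83)).factorization (pp : ℕ) = 22 := by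
        rw [hp, WRow.factorization_frey31117999167337103924704 (by norm_num)]; norm_num
      rw [hfac'] at hord; push_cast at hord
      have hne : ∀ c : ℕ, (eF pp : ℤ) ≠ (((pp : ℕ) : ℕ) : ℤ) ^ c * ((((pp : ℕ) : ℕ) : ℤ) - 1) :=
        WRow.natCast_ne_pow_mul_sub_one Nat.prime_five pp.2 (by rw [hp]; norm_num) (by rw [hp]; norm_num) ⟨6 * l * m, by rw [hm]; ring⟩
      refine ⟨hE, ?_, ?_, ?_, by rw [h3]; push_cast at hord ⊢; linarith [hord], ⟨660 * m, by rw [h3, hm]; ring⟩⟩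
      · have hd := GenuineK.sub_one_div_le_differentOrd_kOf_wild_ratPoint T pp (by rw [hp]; norm_num) (by rw [hp]; norm_num)
          (t := 22) (by norm_num) (by rw [hp]; norm_num)
          (fun v hv => by
            rw [Cor22.ord_jInv_ratPoint_triple_eq isABCTriple_frey31117999167337103924704 v (by rw [hv, hp]; norm_num) (by rw [hv, hp]; norm_num), hv, hfac']) x
        rw [hE] at hd
        rw [show DF pp = 2 * eF pp - 1 by simp [hDF, hp]]
        exact hd
      · rw [show rinF pp = 1 by simp [hrinF, hp]]
        exact WRow.inner_witness_trivial (pp : ℕ) _ (eF pp)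
      · exact WRow.outer_member_min (pp : ℕ) hE hne 10 11 (show (((pp : ℕ) : ℕ) : ℤ) = 3 by exact_mod_cast hp) (by simp [hroutF, hp])
    · -- `p = 5`: `e = 60·l·m`, `h = 8`
      simp only [hp] at hm; norm_num at hm
      have h3 : hF pp = 8 := by simp [hhF, hp]
      have hfac' : (2 ^ 5 * 67 ^ 8 * 107 * 22381 * (5 ^ 4 * 53 ^ 6 * 353 ^ 5) * (3 ^ 22 * 7 ^ 14 * 43 * 83)).factorization (pp : ℕ) = 4 := by
        rw [hp, WRow.factorization_frey31117999167337103924704 (by norm_num)]; norm_num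
      rw [hfac'] at hord; push_cast at hord
      have hne : ∀ c : ℕ, (eF pp : ℤ) ≠ (((pp : ℕ) : ℕ) : ℤ) ^ c * ((((pp : ℕ) : ℕ) : ℤ) - 1) :=
        WRow.natCast_ne_pow_mul_sub_one Nat.prime_three pp.2 (by rw [hp]; norm_num) (by rw [hp]; norm_num) ⟨20 * l * m, by rw [hm]; ring⟩
      refine ⟨hE, ?_, ?_, ?_, by rw [h3]; push_cast at hord ⊢; linarith [hord], ⟨240 * m, by rw [h3, hm]; ring⟩⟩
      · have hd := GenuineK.sub_one_div_le_differentOrd_kOf_wild_ratPoint T pp (by rw [hp]; norm_num) (by rw [hp]; norm_num)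
          (t := 4) (by norm_num) (by rw [hp]; norm_num)
          (fun v hv => by
            rw [Cor22.ord_jInv_ratPoint_triple_eq isABCTriple_frey31117999167337103924704 v (by rw [hv, hp]; norm_num) (by rw [hv, hp]; norm_num), hv, hfac']) x
        rw [hE] at hd
        rw [show DF pp = 2 * eF pp - 1 by simp [hDF, hp]]
        exact hd
      · rw [show rinF pp = 1 by simp [hrinF, hp]]
        exact WRow.inner_witness_trivial (pp : ℕ) _ (eF pp)
      · exact WRow.outer_member_min (pp : ℕ) hE hne 1 2 (show (((pp : ℕ) : ℕ) : ℤ) = 5 by exact_mod_cast hp) (by simp [hroutF, hp])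
    · -- `p = 7`: `e = 15·l·m`, `h = 28`
      simp only [hp] at hm; norm_num at hm
      have h3 : hF pp = 28 := by simp [hhF, hp]
      have hfac' : (2 ^ 5 * 67 ^ 8 * 107 * 22381 * (5 ^ 4 * 53 ^ 6 * 353 ^ 5) * (3 ^ 22 * 7 ^ 14 * 43 * 83)).factorization (pp : ℕ) = 14 := by
        rw [hp, WRow.factorization_frey31117999167337103924704 (by norm_num)]; norm_num
      rw [hfac'] at hord; push_cast at hord
      have hne : ∀ c : ℕ, (eF pp : ℤ) ≠ (((pp : ℕ) : ℕ) : ℤ) ^ c * ((((pp : ℕ) : ℕ) : ℤ) - 1) :=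
        WRow.natCast_ne_pow_mul_sub_one Nat.prime_five pp.2 (by rw [hp]; norm_num) (by rw [hp]; norm_num) ⟨3 * l * m, by rw [hm]; ring⟩
      refine ⟨hE, ?_, ?_, ?_, by rw [h3]; push_cast at hord ⊢; linarith [hord], ⟨210 * m, by rw [h3, hm]; ring⟩⟩
      · rw [show DF pp = eF pp - 1 by simp [hDF, hp]]
        exact Cor312Prov.pred_div_le_differentOrd_of_eq (pp : ℕ) hE
      · rw [show rinF pp = 1 by simp [hrinF, hp]]
        exact WRow.inner_witness_trivial (pp : ℕ) _ (eF pp)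
      · exact WRow.outer_member_min (pp : ℕ) hE hne 7 8 (show (((pp : ℕ) : ℕ) : ℤ) = 7 by exact_mod_cast hp) (by simp [hroutF, hp])
    · -- `p = 43`: `e = 30·l·m`, `h = 2`
      simp only [hp] at hm; norm_num at hm
      have h3 : hF pp = 2 := by simp [hhF, hp]
      have hfac' : (2 ^ 5 * 67 ^ 8 * 107 * 22381 * (5 ^ 4 * 53 ^ 6 * 353 ^ 5) * (3 ^ 22 * 7 ^ 14 * 43 * 83)).factorization (pp : ℕ) = 1 := by
        rw [hp, WRow.factorization_frey31117999167337103924704 (by norm_num)]; norm_num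
      rw [hfac'] at hord; push_cast at hord
      have hne : ∀ c : ℕ, (eF pp : ℤ) ≠ (((pp : ℕ) : ℕ) : ℤ) ^ c * ((((pp : ℕ) : ℕ) : ℤ) - 1) :=
        WRow.natCast_ne_pow_mul_sub_one Nat.prime_five pp.2 (by rw [hp]; norm_num) (by rw [hp]; norm_num) ⟨6 * l * m, by rw [hm]; ring⟩
      refine ⟨hE, ?_, ?_, ?_, by rw [h3]; push_cast at hord ⊢; linarith [hord], ⟨30 * m, by rw [h3, hm]; ring⟩⟩
      · rw [show DF pp = eF pp - 1 by simp [hDF, hp]]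
        exact Cor312Prov.pred_div_le_differentOrd_of_eq (pp : ℕ) hE
      · rw [show rinF pp = 1 by simp [hrinF, hp]]
        exact WRow.inner_witness_trivial (pp : ℕ) _ (eF pp)
      · exact WRow.outer_member_min (pp : ℕ) hE hne 0 1 (show (((pp : ℕ) : ℕ) : ℤ) = 43 by exact_mod_cast hp) (by simp [hroutF, hp])
    · -- `p = 53`: `e = 5·l·m`, `h = 12`
      simp only [hp] at hm; norm_num at hm
      have h3 : hF pp = 12 := by simp [hhF, hp]
      have hfac' : (2 ^ 5 * 67 ^ 8 * 107 * 22381 * (5 ^ 4 * 53 ^ 6 * 353 ^ 5) * (3 ^ 22 * 7 ^ 14 * 43 * 83)).factorization (pp : ℕ) = 6 := by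
        rw [hp, WRow.factorization_frey31117999167337103924704 (by norm_num)]; norm_num
      rw [hfac'] at hord; push_cast at hord
      have hne : ∀ c : ℕ, (eF pp : ℤ) ≠ (((pp : ℕ) : ℕ) : ℤ) ^ c * ((((pp : ℕ) : ℕ) : ℤ) - 1) :=
        WRow.natCast_ne_pow_mul_sub_one Nat.prime_five pp.2 (by rw [hp]; norm_num) (by rw [hp]; norm_num) ⟨1 * l * m, by rw [hm]; ring⟩
      refine ⟨hE, ?_, ?_, ?_, by rw [h3]; push_cast at hord ⊢; linarith [hord], ⟨30 * m, by rw [h3, hm]; ring⟩⟩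
      · rw [show DF pp = eF pp - 1 by simp [hDF, hp]]
        exact Cor312Prov.pred_div_le_differentOrd_of_eq (pp : ℕ) hE
      · rw [show rinF pp = 1 by simp [hrinF, hp]]
        exact WRow.inner_witness_trivial (pp : ℕ) _ (eF pp)
      · exact WRow.outer_member_min (pp : ℕ) hE hne 3 4 (show (((pp : ℕ) : ℕ) : ℤ) = 53 by exact_mod_cast hp) (by simp [hroutF, hp])
    · -- `p = 67`: `e = 15·l·m`, `h = 16`
      simp only [hp] at hm; norm_num at hm
      have h3 : hF pp = 16 := by simp [hhF, hp]
      have hfac' : (2 ^ 5 * 67 ^ 8 * 107 * 22381 * (5 ^ 4 * 53 ^ 6 * 353 ^ 5) * (3 ^ 22 * 7 ^ 14 * 43 * 83)).factorization (pp : ℕ) = 8 := by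
        rw [hp, WRow.factorization_frey31117999167337103924704 (by norm_num)]; norm_num
      rw [hfac'] at hord; push_cast at hord
      have hne : ∀ c : ℕ, (eF pp : ℤ) ≠ (((pp : ℕ) : ℕ) : ℤ) ^ c * ((((pp : ℕ) : ℕ) : ℤ) - 1) :=
        WRow.natCast_ne_pow_mul_sub_one Nat.prime_five pp.2 (by rw [hp]; norm_num) (by rw [hp]; norm_num) ⟨3 * l * m, by rw [hm]; ring⟩
      refine ⟨hE, ?_, ?_, ?_, by rw [h3]; push_cast at hord ⊢; linarith [hord], ⟨120 * m, by rw [h3, hm]; ring⟩⟩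
      · rw [show DF pp = eF pp - 1 by simp [hDF, hp]]
        exact Cor312Prov.pred_div_le_differentOrd_of_eq (pp : ℕ) hE
      · rw [show rinF pp = (((eF pp / 66 : ℕ)) : ℤ) by simp [hrinF, hp]]
        exact WRow.inner_witness_slot (pp : ℕ) (by rw [hp]; norm_num) hE (by rw [hp])
      · exact WRow.outer_member_min (pp : ℕ) hE hne 3 4 (show (((pp : ℕ) : ℕ) : ℤ) = 67 by exact_mod_cast hp) (by simp [hroutF, hp])
    · -- `p = 83`: `e = 30·l·m`, `h = 2`
      simp only [hp] at hm; norm_num at hm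
      have h3 : hF pp = 2 := by simp [hhF, hp]
      have hfac' : (2 ^ 5 * 67 ^ 8 * 107 * 22381 * (5 ^ 4 * 53 ^ 6 * 353 ^ 5) * (3 ^ 22 * 7 ^ 14 * 43 * 83)).factorization (pp : ℕ) = 1 := by
        rw [hp, WRow.factorization_frey31117999167337103924704 (by norm_num)]; norm_num
      rw [hfac'] at hord; push_cast at hord
      have hne : ∀ c : ℕ, (eF pp : ℤ) ≠ (((pp : ℕ) : ℕ) : ℤ) ^ c * ((((pp : ℕ) : ℕ) : ℤ) - 1) :=
        WRow.natCast_ne_pow_mul_sub_one Nat.prime_five pp.2 (by rw [hp]; norm_num) (by rw [hp]; norm_num) ⟨6 * l * m, by rw [hm]; ring⟩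
      refine ⟨hE, ?_, ?_, ?_, by rw [h3]; push_cast at hord ⊢; linarith [hord], ⟨30 * m, by rw [h3, hm]; ring⟩⟩
      · rw [show DF pp = eF pp - 1 by simp [hDF, hp]]
        exact Cor312Prov.pred_div_le_differentOrd_of_eq (pp : ℕ) hE
      · rw [show rinF pp = 1 by simp [hrinF, hp]]
        exact WRow.inner_witness_trivial (pp : ℕ) _ (eF pp)
      · exact WRow.outer_member_min (pp : ℕ) hE hne 0 1 (show (((pp : ℕ) : ℕ) : ℤ) = 83 by exact_mod_cast hp) (by simp [hroutF, hp])
    · -- `p = 107`: `e = 15·l·m`, `h = 2`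
      simp only [hp] at hm; norm_num at hm
      have h3 : hF pp = 2 := by simp [hhF, hp]
      have hfac' : (2 ^ 5 * 67 ^ 8 * 107 * 22381 * (5 ^ 4 * 53 ^ 6 * 353 ^ 5) * (3 ^ 22 * 7 ^ 14 * 43 * 83)).factorization (pp : ℕ) = 1 := by
        rw [hp, WRow.factorization_frey31117999167337103924704 (by norm_num)]; norm_num
      rw [hfac'] at hord; push_cast at hord
      have hne : ∀ c : ℕ, (eF pp : ℤ) ≠ (((pp : ℕ) : ℕ) : ℤ) ^ c * ((((pp : ℕ) : ℕ) : ℤ) - 1) :=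
        WRow.natCast_ne_pow_mul_sub_one Nat.prime_five pp.2 (by rw [hp]; norm_num) (by rw [hp]; norm_num) ⟨3 * l * m, by rw [hm]; ring⟩
      refine ⟨hE, ?_, ?_, ?_, by rw [h3]; push_cast at hord ⊢; linarith [hord], ⟨15 * m, by rw [h3, hm]; ring⟩⟩
      · rw [show DF pp = eF pp - 1 by simp [hDF, hp]]
        exact Cor312Prov.pred_div_le_differentOrd_of_eq (pp : ℕ) hE
      · rw [show rinF pp = 1 by simp [hrinF, hp]]
        exact WRow.inner_witness_trivial (pp : ℕ) _ (eF pp)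
      · exact WRow.outer_member_min (pp : ℕ) hE hne 0 1 (show (((pp : ℕ) : ℕ) : ℤ) = 107 by exact_mod_cast hp) (by simp [hroutF, hp])
    · -- `p = 353`: `e = 3·l·m`, `h = 10`
      simp only [hp] at hm; norm_num at hm
      have h3 : hF pp = 10 := by simp [hhF, hp]
      have hfac' : (2 ^ 5 * 67 ^ 8 * 107 * 22381 * (5 ^ 4 * 53 ^ 6 * 353 ^ 5) * (3 ^ 22 * 7 ^ 14 * 43 * 83)).factorization (pp : ℕ) = 5 := by
        rw [hp, WRow.factorization_frey31117999167337103924704 (by norm_num)]; norm_num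
      rw [hfac'] at hord; push_cast at hord
      have hne : ∀ c : ℕ, (eF pp : ℤ) ≠ (((pp : ℕ) : ℕ) : ℤ) ^ c * ((((pp : ℕ) : ℕ) : ℤ) - 1) :=
        WRow.natCast_ne_pow_mul_sub_one Nat.prime_three pp.2 (by rw [hp]; norm_num) (by rw [hp]; norm_num) ⟨1 * l * m, by rw [hm]; ring⟩
      refine ⟨hE, ?_, ?_, ?_, by rw [h3]; push_cast at hord ⊢; linarith [hord], ⟨15 * m, by rw [h3, hm]; ring⟩⟩
      · rw [show DF pp = eF pp - 1 by simp [hDF, hp]]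
        exact Cor312Prov.pred_div_le_differentOrd_of_eq (pp : ℕ) hE
      · rw [show rinF pp = 1 by simp [hrinF, hp]]
        exact WRow.inner_witness_trivial (pp : ℕ) _ (eF pp)
      · exact WRow.outer_member_min (pp : ℕ) hE hne 2 3 (show (((pp : ℕ) : ℕ) : ℤ) = 353 by exact_mod_cast hp) (by simp [hroutF, hp])
    · -- `p = 22381`: `e = 15·l·m`, `h = 2`
      simp only [hp] at hm; norm_num at hm
      have h3 : hF pp = 2 := by simp [hhF, hp]
      have hfac' : (2 ^ 5 * 67 ^ 8 * 107 * 22381 * (5 ^ 4 * 53 ^ 6 * 353 ^ 5) * (3 ^ 22 * 7 ^ 14 * 43 * 83)).factorization (pp : ℕ) = 1 := by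
        rw [hp, WRow.factorization_frey31117999167337103924704 (by norm_num)]; norm_num
      rw [hfac'] at hord; push_cast at hord
      have hne : ∀ c : ℕ, (eF pp : ℤ) ≠ (((pp : ℕ) : ℕ) : ℤ) ^ c * ((((pp : ℕ) : ℕ) : ℤ) - 1) :=
        WRow.natCast_ne_pow_mul_sub_one hlP pp.2 (fun h => hpl h.symm)
          (fun h => by rw [hp] at h; have := Nat.le_of_dvd (by norm_num) h; omega) ⟨15 * m, by rw [hm]; ring⟩
      refine ⟨hE, ?_, ?_, ?_, by rw [h3]; push_cast at hord ⊢; linarith [hord], ⟨15 * m, by rw [h3, hm]; ring⟩⟩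
      · rw [show DF pp = eF pp - 1 by simp [hDF, hp]]
        exact Cor312Prov.pred_div_le_differentOrd_of_eq (pp : ℕ) hE
      · rw [show rinF pp = 1 by simp [hrinF, hp]]
        exact WRow.inner_witness_trivial (pp : ℕ) _ (eF pp)
      · exact WRow.outer_member_min (pp : ℕ) hE hne 0 1 (show (((pp : ℕ) : ℕ) : ℤ) = 22381 by exact_mod_cast hp) (by simp [hroutF, hp])
  · -- the integer cells at every label `j = i + 1 ≤ (l−1)/2`, every level `l ≥ 1322706`
    haveI : Fact (pp : ℕ).Prime := ⟨pp.2⟩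
    obtain ⟨x, hx⟩ := hpp
    have hi : (i : ℕ) < (l - 1) / 2 := hlstar ▸ i.isLt
    generalize hk : (i : ℕ) = k at hi ⊢
    obtain ⟨m, hm1, hm⟩ := hshape pp x hx
    obtain ⟨-, -, -, hcases, -⟩ := WRow.bad_prime_frey31117999167337103924704 T pp x hx
    rcases hcases with hp | hp | hp | hp | hp | hp | hp | hp | hp | hp
    · simp only [hp] at hm; norm_num at hm
      have h2 : DF pp = 2 * (30 * l * m) - 1 := by simp [hDF, hp, hm]
      have h3 : hF pp = 44 := by simp [hhF, hp]
      have h4 : rinF pp = (1 : ℤ) := by simp [hrinF, hp]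
      have h5 : routF pp = min ((3 : ℤ) ^ 10 - 10 * (eF pp : ℤ)) ((3 : ℤ) ^ 11 - 11 * (eF pp : ℤ)) := by simp [hroutF, hp]
      rw [h2, h3, h4, h5, hm]
      exact InhBand.cell_frey31117999167337103924704_p3_lo hL hm1 k hi
    · simp only [hp] at hm; norm_num at hm
      have h2 : DF pp = 2 * (60 * l * m) - 1 := by simp [hDF, hp, hm]
      have h3 : hF pp = 8 := by simp [hhF, hp]
      have h4 : rinF pp = (1 : ℤ) := by simp [hrinF, hp]
      have h5 : routF pp = min ((5 : ℤ) ^ 1 - 1 * (eF pp : ℤ)) ((5 : ℤ) ^ 2 - 2 * (eF pp : ℤ)) := by simp [hroutF, hp]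
      rw [h2, h3, h4, h5, hm]
      exact InhBand.cell_frey31117999167337103924704_p5_lo hL hm1 k hi
    · simp only [hp] at hm; norm_num at hm
      have h2 : DF pp = 15 * l * m - 1 := by simp [hDF, hp, hm]
      have h3 : hF pp = 28 := by simp [hhF, hp]
      have h4 : rinF pp = (1 : ℤ) := by simp [hrinF, hp]
      have h5 : routF pp = min ((7 : ℤ) ^ 7 - 7 * (eF pp : ℤ)) ((7 : ℤ) ^ 8 - 8 * (eF pp : ℤ)) := by simp [hroutF, hp]
      rw [h2, h3, h4, h5, hm]
      exact InhBand.cell_frey31117999167337103924704_p7_lo hL hm1 k hi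
    · simp only [hp] at hm; norm_num at hm
      have h2 : DF pp = 30 * l * m - 1 := by simp [hDF, hp, hm]
      have h3 : hF pp = 2 := by simp [hhF, hp]
      have h4 : rinF pp = (1 : ℤ) := by simp [hrinF, hp]
      have h5 : routF pp = min ((43 : ℤ) ^ 0 - 0 * (eF pp : ℤ)) ((43 : ℤ) ^ 1 - 1 * (eF pp : ℤ)) := by simp [hroutF, hp]
      rw [h2, h3, h4, h5, hm]
      exact InhBand.cell_frey31117999167337103924704_p43_lo hL hm1 k hi
    · simp only [hp] at hm; norm_num at hm
      have h2 : DF pp = 5 * l * m - 1 := by simp [hDF, hp, hm]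
      have h3 : hF pp = 12 := by simp [hhF, hp]
      have h4 : rinF pp = (1 : ℤ) := by simp [hrinF, hp]
      have h5 : routF pp = min ((53 : ℤ) ^ 3 - 3 * (eF pp : ℤ)) ((53 : ℤ) ^ 4 - 4 * (eF pp : ℤ)) := by simp [hroutF, hp]
      rw [h2, h3, h4, h5, hm]
      exact InhBand.cell_frey31117999167337103924704_p53_lo hL hm1 k hi
    · simp only [hp] at hm; norm_num at hm
      have h2 : DF pp = 15 * l * m - 1 := by simp [hDF, hp, hm]
      have h3 : hF pp = 16 := by simp [hhF, hp]
      have h4 : rinF pp = (((15 * l * m / 66 : ℕ)) : ℤ) := by simp [hrinF, hp, hm]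
      have h5 : routF pp = min ((67 : ℤ) ^ 3 - 3 * (eF pp : ℤ)) ((67 : ℤ) ^ 4 - 4 * (eF pp : ℤ)) := by simp [hroutF, hp]
      rw [h2, h3, h4, h5, hm]
      exact InhBand.cell_frey31117999167337103924704_p67_levels hl4 hm1 k hi
    · simp only [hp] at hm; norm_num at hm
      have h2 : DF pp = 30 * l * m - 1 := by simp [hDF, hp, hm]
      have h3 : hF pp = 2 := by simp [hhF, hp]
      have h4 : rinF pp = (1 : ℤ) := by simp [hrinF, hp]
      have h5 : routF pp = min ((83 : ℤ) ^ 0 - 0 * (eF pp : ℤ)) ((83 : ℤ) ^ 1 - 1 * (eF pp : ℤ)) := by simp [hroutF, hp]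
      rw [h2, h3, h4, h5, hm]
      exact InhBand.cell_frey31117999167337103924704_p83_lo hL hm1 k hi
    · simp only [hp] at hm; norm_num at hm
      have h2 : DF pp = 15 * l * m - 1 := by simp [hDF, hp, hm]
      have h3 : hF pp = 2 := by simp [hhF, hp]
      have h4 : rinF pp = (1 : ℤ) := by simp [hrinF, hp]
      have h5 : routF pp = min ((107 : ℤ) ^ 0 - 0 * (eF pp : ℤ)) ((107 : ℤ) ^ 1 - 1 * (eF pp : ℤ)) := by simp [hroutF, hp]
      rw [h2, h3, h4, h5, hm]
      exact InhBand.cell_frey31117999167337103924704_p107_lo hL hm1 k hi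
    · simp only [hp] at hm; norm_num at hm
      have h2 : DF pp = 3 * l * m - 1 := by simp [hDF, hp, hm]
      have h3 : hF pp = 10 := by simp [hhF, hp]
      have h4 : rinF pp = (1 : ℤ) := by simp [hrinF, hp]
      have h5 : routF pp = min ((353 : ℤ) ^ 2 - 2 * (eF pp : ℤ)) ((353 : ℤ) ^ 3 - 3 * (eF pp : ℤ)) := by simp [hroutF, hp]
      rw [h2, h3, h4, h5, hm]
      exact InhBand.cell_frey31117999167337103924704_p353_lo hL hm1 k hi
    · simp only [hp] at hm; norm_num at hm
      have h2 : DF pp = 15 * l * m - 1 := by simp [hDF, hp, hm]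
      have h3 : hF pp = 2 := by simp [hhF, hp]
      have h4 : rinF pp = (1 : ℤ) := by simp [hrinF, hp]
      have h5 : routF pp = min ((22381 : ℤ) ^ 0 - 0 * (eF pp : ℤ)) ((22381 : ℤ) ^ 1 - 1 * (eF pp : ℤ)) := by simp [hroutF, hp]
      rw [h2, h3, h4, h5, hm]
      exact InhBand.cell_frey31117999167337103924704_p22381_lo hL hm1 k hi

end Summit.ABC.IUTFork.Conditional

end
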